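import Literature.NumberTheory.Automorphic.BorelStabilizerLattice
import Literature.NumberTheory.Automorphic.BorelOrbitsFinite
import HarnessLib

/-!
# Boundary points supported at the level and the admissible torus elements commuting with them

Topic `NumberTheory/Automorphic`; namespace `Literature.NumberTheory.Automorphic.BigHeckeGLn`.
A *proofs* file (theorems and one auxiliary definition with body).

Let `𝔫 ≠ 0` be an ideal of `𝓞_K`, `L = K_f(𝔫) ≤ GL₂(𝔸_K^∞)` and `S = {v : v ∣ 𝔫}`.

* `supportedPart S k hk = k · (awayPart S k)⁻¹` — the part of `k ∈ GL₂(𝒪̂)` supported at `S`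
  (local components `k_v` for `v ∈ S`, `1` away from `S`); `diag(t) k L = diag(t) k_S L`
  (`coe_glDiagonal_mul_eq_coe_glDiagonal_mul_supportedPart`), so the orbit representatives
  `diag(t) c K_f(𝔫)` of `BorelOrbitsFinite` may be taken with `c` supported at `S`;
* `admissibleDiag x = ι(diag(1, x))` for `x ∈ 𝓞_K ∖ 0` with `x ≡ 1 mod 𝔫` lies in `K_v(𝔫)` at
  every `v ∣ 𝔫` (`localComponent_admissibleDiag_mem`);
* **orbit condition** (`orbitCondition_admissibleDiag`): for `y = diag(t) c` with `c ∈ GL₂(𝒪̂)`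
  supported at `S`, `y⁻¹ ι(diag(1,x))⁻¹ y ι(diag(1,x)) ∈ K_f(𝔫)`, i.e.
  `y · ι(t_x) · K_f(𝔫) = ι(t_x) · y · K_f(𝔫)` — the hypothesis (★) of `HeckeOrbitConjugation` for the
  Hecke operators `T_{ι(t_x)}` restricted to the `B(K)`-orbit of `y` [Harder1987, §2].

## References

* G. Harder, *Eisenstein cohomology of arithmetic groups. The case GL₂*, Invent. Math. 89 (1987), §2.
  [Harder1987]
* G. Shimura, *Introduction to the arithmetic theory of automorphic functions* (1971), Ch. 3.
  [ShimuraIATAF1971]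
-/

noncomputable section

open scoped NumberField
open IsDedekindDomain

namespace Literature.NumberTheory.Automorphic.BigHeckeGLn

variable {K : Type} [Field K] [NumberField K]

/-! ### The part of an integral element supported at `S` -/

/-- **The part of `k ∈ GL₂(𝒪̂)` supported at `S`**: local components `k_v` (`v ∈ S`), `1` (`v ∉ S`).
[folklore] -/
def supportedPart {n : ℕ} (S : Set (HeightOneSpectrum (𝓞 K))) (k : FiniteAdelicGL n K)
    (hk : k ∈ glFiniteIntegralLevel n K) : FiniteAdelicGL n K :=
  k * (awayPart S hk)⁻¹

/-- Local components of `supportedPart` at `v ∈ S`. [folklore] -/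
theorem localComponent_supportedPart_of_mem {n : ℕ} {S : Set (HeightOneSpectrum (𝓞 K))}
    {k : FiniteAdelicGL n K} (hk : k ∈ glFiniteIntegralLevel n K) {v : HeightOneSpectrum (𝓞 K)} (hv : v ∈ S) :
    localComponent n K v (supportedPart S k hk) = localComponent n K v k := by
  rw [supportedPart, map_mul, map_inv, localComponent_awayPart_of_mem hk hv, inv_one, mul_one]

/-- Local components of `supportedPart` at `v ∉ S`. [folklore] -/
theorem localComponent_supportedPart_of_not_mem {n : ℕ} {S : Set (HeightOneSpectrum (𝓞 K))}
    {k : FiniteAdelicGL n K} (hk : k ∈ glFiniteIntegralLevel n K) {v : HeightOneSpectrum (𝓞 K)} (hv : v ∉ S) :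
    localComponent n K v (supportedPart S k hk) = 1 := by
  rw [supportedPart, map_mul, map_inv, localComponent_awayPart_of_not_mem hk hv, mul_inv_cancel]

/-- `supportedPart` is integral. [folklore] -/
theorem supportedPart_mem_glFiniteIntegralLevel {n : ℕ} (S : Set (HeightOneSpectrum (𝓞 K)))
    {k : FiniteAdelicGL n K} (hk : k ∈ glFiniteIntegralLevel n K) :
    supportedPart S k hk ∈ glFiniteIntegralLevel n K :=
  mul_mem hk (inv_mem (awayPart_mem_glFiniteIntegralLevel S hk))

/-- For `S ⊇ {v ∣ 𝔫}`: `k_S⁻¹ k = awayPart ∈ K_f(𝔫)`. [folklore] -/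
theorem awayPart_mem_comap_principalCongruenceLevel {n : ℕ} {𝔫 : Ideal (𝓞 K)} (h𝔫 : 𝔫 ≠ 0)
    {S : Set (HeightOneSpectrum (𝓞 K))} (hS : ∀ v : HeightOneSpectrum (𝓞 K), v.asIdeal ∣ 𝔫 → v ∈ S)
    {k : FiniteAdelicGL n K} (hk : k ∈ glFiniteIntegralLevel n K) :
    awayPart S hk ∈ (principalCongruenceLevel n K 𝔫).comap (GLn.ofFinite n K) := by
  rw [mem_comap_principalCongruenceLevel_iff_localComponent]
  intro v
  by_cases hv : v ∈ S
  · rw [localComponent_awayPart_of_mem hk hv]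
    exact one_mem _
  · rw [localComponent_awayPart_of_not_mem hk hv, idealRadius_eq_one_of_not_dvd h𝔫 (fun h => hv (hS v h))]
    exact localComponent_mem_valuedCongruenceSubgroup_one hk v

/-- **`diag(t) k K_f(𝔫) = diag(t) k_S K_f(𝔫)`**: the boundary points `diag(t) c K_f(𝔫)` may be
represented with `c` supported at the primes of `𝔫`. [cite: Harder1987, §2] -/
theorem coe_glDiagonal_mul_eq_coe_glDiagonal_mul_supportedPart {n : ℕ} {𝔫 : Ideal (𝓞 K)} (h𝔫 : 𝔫 ≠ 0)
    {S : Set (HeightOneSpectrum (𝓞 K))} (hS : ∀ v : HeightOneSpectrum (𝓞 K), v.asIdeal ∣ 𝔫 → v ∈ S)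
    (t : Fin n → (FiniteAdeleRing (𝓞 K) K)ˣ) {k : FiniteAdelicGL n K} (hk : k ∈ glFiniteIntegralLevel n K) :
    ((glDiagonal n (FiniteAdeleRing (𝓞 K) K) t * k : FiniteAdelicGL n K) :
        FiniteAdelicGL n K ⧸ (principalCongruenceLevel n K 𝔫).comap (GLn.ofFinite n K)) =
      ((glDiagonal n (FiniteAdeleRing (𝓞 K) K) t * supportedPart S k hk : FiniteAdelicGL n K) :
        FiniteAdelicGL n K ⧸ (principalCongruenceLevel n K 𝔫).comap (GLn.ofFinite n K)) := by
  rw [QuotientGroup.eq, supportedPart, mul_inv_rev, mul_assoc, inv_mul_cancel_left, ← mul_assoc, inv_mul_cancel,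
    one_mul]
  exact inv_mem (awayPart_mem_comap_principalCongruenceLevel h𝔫 hS hk)

/-! ### The admissible torus elements `ι(diag(1, x))`, `x ≡ 1 mod 𝔫` -/

/-- `diag(1, x) ∈ GL₂(K)` for `x ≠ 0`. [folklore] -/
def diagOneX (x : K) (hx : x ≠ 0) : GL (Fin 2) K :=
  glDiagonal 2 K ![1, Units.mk0 x hx]

omit [NumberField K] in
/-- Entries of `diag(1, x)`. [folklore] -/
theorem coe_diagOneX (x : K) (hx : x ≠ 0) :
    (diagOneX x hx : Matrix (Fin 2) (Fin 2) K) = Matrix.diagonal ![1, x] := by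
  rw [diagOneX, coe_glDiagonal]
  congr 1
  funext k
  fin_cases k <;> rfl

omit [NumberField K] in
/-- `diag(1, x)⁻¹ = diag(1, x⁻¹)`. [folklore] -/
theorem diagOneX_inv (x : K) (hx : x ≠ 0) : (diagOneX x hx)⁻¹ = diagOneX x⁻¹ (inv_ne_zero hx) := by
  rw [diagOneX, diagOneX, ← map_inv]
  congr 1
  funext k
  fin_cases k
  · simp
  · simp [Units.mk0]

/-- **The admissible torus element `ι(diag(1, x)) ∈ GL₂(𝔸_K^∞)`.** [cite: Harder1987, §2] -/
def admissibleDiag (x : K) (hx : x ≠ 0) : FiniteAdelicGL 2 K :=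
  globalEmbedding 2 K (diagOneX x hx)

/-- `ι(diag(1,x))` is a diagonal finite idele matrix. [folklore] -/
theorem admissibleDiag_eq_glDiagonal (x : K) (hx : x ≠ 0) :
    admissibleDiag x hx = glDiagonal 2 (FiniteAdeleRing (𝓞 K) K)
      (fun i => IsDedekindDomain.FiniteAdeleRing.unitEmbedding (𝓞 K) K (![1, Units.mk0 x hx] i)) := by
  rw [admissibleDiag, diagOneX, globalEmbedding_glDiagonal]

/-- Diagonal finite idele matrices commute. [folklore] -/
theorem glDiagonal_mul_comm {n : ℕ} (a b : Fin n → (FiniteAdeleRing (𝓞 K) K)ˣ) :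
    glDiagonal n (FiniteAdeleRing (𝓞 K) K) a * glDiagonal n (FiniteAdeleRing (𝓞 K) K) b =
      glDiagonal n (FiniteAdeleRing (𝓞 K) K) b * glDiagonal n (FiniteAdeleRing (𝓞 K) K) a := by
  rw [← map_mul, ← map_mul, mul_comm]

/-- `diag(t)` commutes with `ι(diag(1, x))`. [folklore] -/
theorem glDiagonal_mul_admissibleDiag (t : Fin 2 → (FiniteAdeleRing (𝓞 K) K)ˣ) (x : K) (hx : x ≠ 0) :
    glDiagonal 2 (FiniteAdeleRing (𝓞 K) K) t * admissibleDiag x hx =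
      admissibleDiag x hx * glDiagonal 2 (FiniteAdeleRing (𝓞 K) K) t := by
  rw [admissibleDiag_eq_glDiagonal, glDiagonal_mul_comm]

/-- The local valuations of the entries of `ι(γ)`. [folklore] -/
theorem valued_localComponent_globalEmbedding_apply (γ : GL (Fin 2) K) (v : HeightOneSpectrum (𝓞 K)) (i j : Fin 2) :
    Valued.v ((localComponent 2 K v (globalEmbedding 2 K γ) : Matrix (Fin 2) (Fin 2) (v.adicCompletion K)) i j) =
      v.valuation K ((γ : Matrix (Fin 2) (Fin 2) K) i j) := by
  rw [localComponent_globalEmbedding]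
  change Valued.v (algebraMap K (v.adicCompletion K) ((γ : Matrix (Fin 2) (Fin 2) K) i j)) = _
  exact HeightOneSpectrum.valuedAdicCompletion_eq_valuation' v _

/-- `|c|_v ≤ |𝔫|_v` for `c ∈ 𝔫 ≠ 0` (a copy of the tree's `intValuation_le_idealRadius_of_mem` of
`TestFunctionGLLeftInvariance`, to keep the imports light). [folklore] -/
theorem intValuation_le_idealRadius_of_mem' {𝔫 : Ideal (𝓞 K)} (h𝔫 : 𝔫 ≠ 0) {c : 𝓞 K}
    (hc : c ∈ 𝔫) (v : HeightOneSpectrum (𝓞 K)) : v.intValuation c ≤ idealRadius K v 𝔫 := by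
  classical
  set e : ℕ := (Associates.mk v.asIdeal).count (Associates.mk 𝔫).factors with he
  have hrad : idealRadius K v 𝔫 = WithZero.exp (-(e : ℤ)) := by
    rw [idealRadius, FractionalIdeal.count_coe K v h𝔫]
  rw [hrad, HeightOneSpectrum.intValuation_le_pow_iff_mem]
  have hdvd : v.asIdeal ^ e ∣ 𝔫 := by
    rw [← Associates.mk_le_mk_iff_dvd, Associates.mk_pow]
    exact (Associates.prime_pow_dvd_iff_le (Associates.mk_ne_zero.mpr h𝔫) v.associates_irreducible).mpr le_rfl
  exact Ideal.le_of_dvd hdvd hc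

/-- `|𝔫|_v < 1` for `v ∣ 𝔫 ≠ 0` (as the tree's `idealRadius_lt_one_of_dvd` of `GJUnfoldingData`). [folklore] -/
theorem idealRadius_lt_one_of_dvd' {𝔫 : Ideal (𝓞 K)} (h𝔫 : 𝔫 ≠ 0) {w : HeightOneSpectrum (𝓞 K)}
    (hw : w.asIdeal ∣ 𝔫) : idealRadius K w 𝔫 < 1 := by
  rw [idealRadius, ← WithZero.exp_zero, WithZero.exp_lt_exp, neg_lt_zero, FractionalIdeal.count_coe K w h𝔫,
    Nat.cast_pos, Nat.pos_iff_ne_zero]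
  exact (Associates.count_ne_zero_iff_dvd h𝔫 w.irreducible).2 hw

/-- `|x|_v = 1` when `|x - 1|_v < 1`. [folklore] -/
theorem valuation_eq_one_of_valuation_sub_one_lt (v : HeightOneSpectrum (𝓞 K)) {x : K}
    (h : v.valuation K (x - 1) < 1) : v.valuation K x = 1 := by
  have := Valuation.map_add_eq_of_lt_left (v.valuation K) (x := 1) (y := x - 1) (by rwa [Valuation.map_one])
  rwa [add_sub_cancel, Valuation.map_one] at this

/-- **`ι(diag(1, x))_v ∈ K_v(𝔫)` for `v ∣ 𝔫`** when `x ∈ 𝓞_K`, `x ≡ 1 mod 𝔫`. [cite: Harder1987, §2] -/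
theorem localComponent_admissibleDiag_mem {𝔫 : Ideal (𝓞 K)} (h𝔫 : 𝔫 ≠ 0) (x : 𝓞 K) (hx : (x : K) ≠ 0)
    (hx1 : x - 1 ∈ 𝔫) {v : HeightOneSpectrum (𝓞 K)} (hv : v.asIdeal ∣ 𝔫) :
    localComponent 2 K v (admissibleDiag (x : K) hx) ∈ valuedCongruenceSubgroup (Fin 2) (idealRadius K v 𝔫) := by
  have hr : idealRadius K v 𝔫 < 1 := idealRadius_lt_one_of_dvd' h𝔫 hv
  have hx1v : v.valuation K ((x : K) - 1) ≤ idealRadius K v 𝔫 := by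
    have h := intValuation_le_idealRadius_of_mem' h𝔫 hx1 v
    rw [← HeightOneSpectrum.valuation_of_algebraMap (K := K)] at h
    convert h using 2
    push_cast
    ring
  have hxv : v.valuation K (x : K) = 1 := valuation_eq_one_of_valuation_sub_one_lt v (lt_of_le_of_lt hx1v hr)
  have hxinv : v.valuation K (x : K)⁻¹ = 1 := by rw [map_inv₀, hxv, inv_one]
  -- entries of `diag(1, x)` and `diag(1, x⁻¹)`
  have hent : ∀ (y : K) (i j : Fin 2), (Matrix.diagonal ![(1 : K), y]) i j = if i = j then ![(1 : K), y] i else 0 :=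
    fun y i j => by rw [Matrix.diagonal_apply]
  rw [mem_valuedCongruenceSubgroup_iff]
  refine ⟨fun i j => ?_, fun i j => ?_, fun i j => ?_⟩
  · rw [admissibleDiag, valued_localComponent_globalEmbedding_apply, coe_diagOneX, hent]
    split_ifs with h
    · subst h
      fin_cases i
      · simp
      · simp [hxv]
    · simp
  · rw [admissibleDiag, ← map_inv, ← map_inv, diagOneX_inv, valued_localComponent_globalEmbedding_apply,
      coe_diagOneX, hent]
    split_ifs with h
    · subst h
      fin_cases i
      · simp
      · simp [hxinv]
    · simp
  · rw [Matrix.sub_apply, admissibleDiag]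
    have hsub : (localComponent 2 K v (globalEmbedding 2 K (diagOneX (x : K) hx)) : Matrix (Fin 2) (Fin 2)
        (v.adicCompletion K)) i j - (1 : Matrix (Fin 2) (Fin 2) (v.adicCompletion K)) i j =
        algebraMap K (v.adicCompletion K) ((diagOneX (x : K) hx : Matrix (Fin 2) (Fin 2) K) i j - (1 : Matrix (Fin 2) (Fin 2) K) i j) := by
      rw [map_sub, localComponent_globalEmbedding]
      congr 1
      rw [Matrix.one_apply, Matrix.one_apply]
      split_ifs <;> simp
    rw [hsub]
    refine (HeightOneSpectrum.valuedAdicCompletion_eq_valuation' v _).trans_le ?_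
    rw [coe_diagOneX, hent, Matrix.one_apply]
    split_ifs with h
    · subst h
      fin_cases i
      · simp
      · simpa using hx1v
    · simp

/-! ### The orbit condition -/

/-- **Orbit condition for the admissible torus elements**: for `y = diag(t) c` with `c ∈ GL₂(𝒪̂)`
supported at `S = {v ∣ 𝔫}` and `x ∈ 𝓞_K ∖ 0`, `x ≡ 1 mod 𝔫`:
`y⁻¹ ι(t_x)⁻¹ y ι(t_x) ∈ K_f(𝔫)`, i.e. `y ι(t_x) K_f(𝔫) = ι(t_x) y K_f(𝔫)`. [cite: Harder1987, §2] -/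
theorem orbitCondition_admissibleDiag {𝔫 : Ideal (𝓞 K)} (h𝔫 : 𝔫 ≠ 0)
    {S : Set (HeightOneSpectrum (𝓞 K))} (hS : ∀ v : HeightOneSpectrum (𝓞 K), v ∈ S → v.asIdeal ∣ 𝔫)
    (t : Fin 2 → (FiniteAdeleRing (𝓞 K) K)ˣ) {c : FiniteAdelicGL 2 K} (hc : c ∈ glFiniteIntegralLevel 2 K)
    (hcS : ∀ v, v ∉ S → localComponent 2 K v c = 1)
    (x : 𝓞 K) (hx : (x : K) ≠ 0) (hx1 : x - 1 ∈ 𝔫) :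
    (glDiagonal 2 (FiniteAdeleRing (𝓞 K) K) t * c)⁻¹ * (admissibleDiag (x : K) hx)⁻¹ *
        (glDiagonal 2 (FiniteAdeleRing (𝓞 K) K) t * c) * admissibleDiag (x : K) hx ∈
      (principalCongruenceLevel 2 K 𝔫).comap (GLn.ofFinite 2 K) := by
  set d := glDiagonal 2 (FiniteAdeleRing (𝓞 K) K) t with hd
  set g := admissibleDiag (x : K) hx with hg
  -- `d` and `g` commute: the element is `c⁻¹ g⁻¹ c g`
  have hdg : d * g = g * d := glDiagonal_mul_admissibleDiag t (x : K) hx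
  have hred : (d * c)⁻¹ * g⁻¹ * (d * c) * g = c⁻¹ * g⁻¹ * c * g := by
    have hdg' : d⁻¹ * g⁻¹ = g⁻¹ * d⁻¹ := by
      rw [← mul_inv_rev, ← mul_inv_rev, hdg]
    calc (d * c)⁻¹ * g⁻¹ * (d * c) * g = c⁻¹ * (d⁻¹ * g⁻¹) * d * c * g := by group
      _ = c⁻¹ * (g⁻¹ * d⁻¹) * d * c * g := by rw [hdg']
      _ = c⁻¹ * g⁻¹ * c * g := by group
  rw [hred, mem_comap_principalCongruenceLevel_iff_localComponent]
  intro v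
  rw [map_mul, map_mul, map_mul, map_inv, map_inv]
  by_cases hv : v ∈ S
  · -- at `v ∣ 𝔫`: `g_v ∈ K_v(𝔫) ⊲ GL₂(𝒪_v) ∋ c_v`
    have hgv := localComponent_admissibleDiag_mem h𝔫 x hx hx1 (hS v hv)
    have hcv := localComponent_mem_valuedCongruenceSubgroup_one hc v
    have hconj := conj_mem_valuedCongruenceSubgroup (idealRadius_le_one' (K := K) v 𝔫) (inv_mem hcv) (inv_mem hgv)
    rw [inv_inv] at hconj
    exact mul_mem hconj hgv
  · -- away from `S`: `c_v = 1`
    rw [hcS v hv, inv_one, one_mul, mul_one, inv_mul_cancel]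
    exact one_mem _

/-- The same with `S = {v ∣ 𝔫}` and the supported part of an arbitrary `c ∈ GL₂(𝒪̂)`. [cite: Harder1987, §2] -/
theorem orbitCondition_admissibleDiag_supportedPart {𝔫 : Ideal (𝓞 K)} (h𝔫 : 𝔫 ≠ 0)
    (t : Fin 2 → (FiniteAdeleRing (𝓞 K) K)ˣ) {c : FiniteAdelicGL 2 K} (hc : c ∈ glFiniteIntegralLevel 2 K)
    (x : 𝓞 K) (hx : (x : K) ≠ 0) (hx1 : x - 1 ∈ 𝔫) :
    (glDiagonal 2 (FiniteAdeleRing (𝓞 K) K) t * supportedPart {v | v.asIdeal ∣ 𝔫} c hc)⁻¹ *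
        (admissibleDiag (x : K) hx)⁻¹ *
        (glDiagonal 2 (FiniteAdeleRing (𝓞 K) K) t * supportedPart {v | v.asIdeal ∣ 𝔫} c hc) *
        admissibleDiag (x : K) hx ∈
      (principalCongruenceLevel 2 K 𝔫).comap (GLn.ofFinite 2 K) :=
  orbitCondition_admissibleDiag h𝔫 (fun _ hv => hv) t (supportedPart_mem_glFiniteIntegralLevel _ hc)
    (fun _ hv => localComponent_supportedPart_of_not_mem hc hv) x hx hx1

end Literature.NumberTheory.Automorphic.BigHeckeGLn
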